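import Summits.FinalStateConjecture.FinalStateConjecture.Theorems.ClusterCompletenessOmegaLimitMultiKerrPenetratingSlab
import Summits.FinalStateConjecture.FinalStateConjecture.Theorems.ClusterCompletenessOmegaLimitMultiKerrHoleOmegaLimits
import Literature.Geometry.Lorentzian.KerrCollarConvergence
import HarnessLib

/-!
# Route ClusterCompleteness · crux `OmegaLimitMultiKerr` — the ω-limit dictionary in crux currency
# for hole charts defined across the horizon (star charts restricted to the exterior background)

Structure lemmas for the crux stmt-FinalStateConjecture-14664
(`ClusterCompleteness.OmegaLimitMultiKerr`), line `Sketch`, lead gen 4, stub `StarHoleDictionary`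
(registered main theorem
`tendsto_truncDeviationCk_restrict_star_iff_iteratedFDeriv_omegaLimit_eq_zero`, closed form).

The recur-disjunct `Recurs k 𝒟` of the crux (`ClusterCompletenessOmegaLimitMultiKerrDefs`) measures
recurrence of HOLE CHARTS `Ψ : (boostedKerrBackground Λ c M a).domain → 𝒟` on the boosted EXTERIOR
`{r(Λ⁻¹(x − c)) > max r₊ 0}` by `truncDeviationCk (boostedKerrBackground Λ c M a) Ψ k R' τ → 0`
along chart times, at EVERY radius `R'`. The ω-limit dictionary for such charts
(`ClusterCompletenessOmegaLimitMultiKerrHoleOmegaLimits`) has one asymmetry — recurrence forces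
every ω-limit of the deviation translates to be flat on `{t* = 0}`, but a flat ω-limit gives
recurrence only on COMPACT parts of the open exterior — which
`ClusterCompletenessOmegaLimitMultiKerrPenetratingSlab` removed for ABSTRACT fields `h` of class
`C^{k+1}` on the horizon-penetrating star domain
`(starBackground Λ c M a rf).domain = {r(Λ⁻¹(x − c)) > max M 0}` (`NearKerrLeaf`), where the closed
truncated slabs `{t* = 0, r₊ ≤ r ≤ R'}` are compact for sub-extremal labels. This file puts that
equivalence in CRUX CURRENCY. A hole chart "with margin" is a chart
`Ψ : (starBackground Λ c M a rf).domain → 𝓢` of a spacetime `𝓢` on the STAR background (the era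
charts of near-Kerr leaves, `IsNearKerrLeaf`, are of this kind); what the crux sees is its
RESTRICTION `Ψ ∘ Opens.inclusion _` to `boostedKerrBackground Λ c M a` along
`boostedKerrExterior_le_starBackground_domain` (same reference form `boostedKerrBilin Λ c M a` and
same time `t*`; the radius parameter `rf` of the star background is immaterial except where said):

* `deviationExtend_restrict_star_of_mem`, `truncDeviationCk_restrict_star_eq` — on the exterior the
  deviation of the restricted chart IS the deviation `dev★ = Ψ^* g − g_{M,a,Λ,c}` of the star chart
  (`Spacetime.deviationExtend_comp_inclusion_of_mem / supCkENorm_deviationExtend_comp_inclusion` of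
  `KerrCollarConvergence`), so the crux's `truncDeviationCk` of the restricted chart is the `Cᵏ` sup
  norm of `dev★` over the exterior truncated slab;
  `truncDeviationCk_restrict_star_eq_supCkENorm_translate` — equivalently the `Cᵏ` sup norm over the
  time-ZERO exterior truncated slab of the translate `dev★ (· + τ • Λ∂₀)`
  (`image_add_smul_truncTimeSlab`, `supCkENorm_comp_add_right` of `…Translates`);
  `isLateChart_restrict_star` — a late chart for the star background restricts to a late chart for
  the exterior background (`IsLateChart.comp_inclusion`);
* `contDiffOn_deviationExtend_star` — `dev★` is `C^∞` on the star domain for a smooth star chart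
  (`Spacetime.contDiffAt_deviationExtend_model`; the boosted Kerr–Schild form is smooth wherever the
  rest-frame radius is positive, `contDiffAt_boostedKerrBilin`, and `r > max M 0 ≥ 0` there);
* `exists_omegaLimit_starHole_translate` — with the Kerr–Schild radius as radius parameter, a smooth
  star chart that is TAME after `τ₀` (finite `C^{k+1}` sup norm of `dev★` over every star truncated
  late region `{t* > τ₀, r ≤ R}`) has, along every `T n → +∞`, a subsequence of translates
  `dev★ (· + T (φ n) • Λ∂₀)` converging in `Cᵏ` on every compact subset of the STAR domain (the star
  twin of `exists_omegaLimit_hole_translate`: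
  `exists_omegaLimit_translate_of_bounded_truncLateRegion` with
  `add_smul_mem_starBackground_domain`, `KerrSchildChart.time_add_smul / radius_add_smul`);
* `tendsto_truncDeviationCk_restrict_star_iff_iteratedFDeriv_omegaLimit_eq_zero` (MAIN, registered,
  closed form) — THE DICTIONARY: for `(M, a)` sub-extremal, `Ψ` a smooth star chart, `g` of class
  `Cᵏ` on the star domain and `T n` chart times along which the translates `dev★ (· + T n • Λ∂₀)`
  converge to `g` in `Cᵏ` on the compacts of the star domain, the RESTRICTED chart recurs at every
  exterior radius along `T`
  (`truncDeviationCk (boostedKerrBackground Λ c M a) (Ψ ∘ ι) k R' (T n) → 0` for all `R'`, the hole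
  clause of `Recurs k 𝒟` along `T`) IFF `g` is flat to order `k` on the
  exterior time-zero slab `{t* = 0} ∩ {r > max r₊ 0}`
  (`tendsto_supCkENorm_truncTimeSlab_translate_iff_iteratedFDeriv_eq_zero_timeSlab` of
  `…PenetratingSlab`, read through the identities above);
* `starHole_omegaLimit_flat_of_recurrence` — packaged: a tame smooth star chart whose restriction
  recurs along `T n → ∞` at every radius has, along a subsequence of `T`, a `Cᵏ_loc` ω-limit on the
  STAR domain which is flat to order `k` on the CLOSED slab `{t* = 0, r ≥ r₊}`
  (`iteratedFDeriv_eq_zero_closedSlab_of_eq_zero_timeSlab`).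

LaSalle reading of the recur-disjunct (the orbit recurs to the reference configuration along `T`
iff the latter is its ω-limit along `T`): Hale 1980, Ch. I, §8; `Cᵏ` Arzelà–Ascoli currency:
Petersen 2006, Ch. 10, §3.1; Kerr-star coordinates regular across `𝓗⁺`: Dafermos–Rodnianski 2008,
§5.1. Everything is proved; Mathlib + `Literature` + landed `Theorems` files only, no definitions.
-/

-- every `Summit.FinalStateConjecture.FinalStateConjecture.…` name repeats the summit = sub-problem segment (D-0017 layout)
set_option linter.dupNamespace false

noncomputable section

open scoped Manifold ContDiff Topology ENNReal
open Set Filter TopologicalSpace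

namespace Summit.FinalStateConjecture.FinalStateConjecture.Theorems.ClusterCompleteness

open Literature.Geometry.Lorentzian

/-! ### Restriction of a star chart to the exterior background: the deviations agree -/

/-- **On the exterior, the deviation of the restricted chart is the deviation of the star chart.**
For a smooth chart `Ψ` on `starBackground Λ c M a rf` and `z` in the boosted exterior
`{r(Λ⁻¹(x − c)) > max r₊ 0}`, the extended deviation of `Ψ ∘ ι` from `boostedKerrBackground Λ c M a`
at `z` equals the extended deviation of `Ψ` from the star background at `z`: both backgrounds carry
the boosted Kerr–Schild form `boostedKerrBilin Λ c M a`, and the inclusion `ι` of open subsets of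
`E4` has identity differential (`Spacetime.deviationExtend_comp_inclusion_of_mem`; Kerr-star charts
across `𝓗⁺`: Dafermos–Rodnianski 2008, §5.1). [cite: DafermosRodnianski2008, §5.1] -/
theorem deviationExtend_restrict_star_of_mem (𝓢 : Spacetime 4) (Λ : lorentzGroup) (c : E4)
    (M a : ℝ) (rf : E4 → ℝ) {Ψ : (starBackground Λ c M a rf).domain → 𝓢.carrier}
    (hΨ : ContMDiff 𝓘(ℝ, E4) (𝓡 4) ∞ Ψ) {z : E4} (hz : z ∈ boostedKerrExterior Λ c M a) :
    𝓢.deviationExtend (boostedKerrBackground Λ c M a)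
        (Ψ ∘ Opens.inclusion (boostedKerrExterior_le_starBackground_domain Λ c M a rf)) z =
      𝓢.deviationExtend (starBackground Λ c M a rf) Ψ z :=
  𝓢.deviationExtend_comp_inclusion_of_mem (B := starBackground Λ c M a rf)
    (B' := boostedKerrBackground Λ c M a) (boostedKerrExterior_le_starBackground_domain Λ c M a rf)
    (fun _ ↦ rfl) hΨ hz

/-- **The crux's truncated `Cᵏ` deviation of the restricted chart is the `Cᵏ` sup norm of the star
deviation over the exterior truncated slab.** For a smooth chart `Ψ` on `starBackground Λ c M a rf`
(any radius parameter `rf`),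
`truncDeviationCk (boostedKerrBackground Λ c M a) (Ψ ∘ ι) k R' τ
  = ‖Ψ^* g − g_{M,a,Λ,c}‖_{Cᵏ({t* = τ, r ≤ R'} ∩ {r > max r₊ 0})}`:
the two extended deviations agree on the open exterior, hence so do all their derivatives there
(`Spacetime.supCkENorm_deviationExtend_comp_inclusion`). This is the quantity whose recurrence to
`0` the hole clause of `Recurs k 𝒟` asks (DHRT consequence-form deviation; Kerr-star slabs:
Dafermos–Rodnianski 2008, §5.1). [cite: DafermosRodnianski2008, §5.1] -/
theorem truncDeviationCk_restrict_star_eq (𝓢 : Spacetime 4) (Λ : lorentzGroup) (c : E4) (M a : ℝ)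
    (rf : E4 → ℝ) {Ψ : (starBackground Λ c M a rf).domain → 𝓢.carrier}
    (hΨ : ContMDiff 𝓘(ℝ, E4) (𝓡 4) ∞ Ψ) (k : ℕ) (R' τ : ℝ) :
    𝓢.truncDeviationCk (boostedKerrBackground Λ c M a)
        (Ψ ∘ Opens.inclusion (boostedKerrExterior_le_starBackground_domain Λ c M a rf)) k R' τ =
      supCkENorm (Subtype.val '' (boostedKerrBackground Λ c M a).truncTimeSlab R' τ) k
        (𝓢.deviationExtend (starBackground Λ c M a rf) Ψ) := by
  have hS : Subtype.val '' (boostedKerrBackground Λ c M a).truncTimeSlab R' τ ⊆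
      ((boostedKerrBackground Λ c M a).domain : Set E4) := by
    rintro _ ⟨x, -, rfl⟩
    exact x.2
  rw [Spacetime.truncDeviationCk]
  exact 𝓢.supCkENorm_deviationExtend_comp_inclusion (B := starBackground Λ c M a rf)
    (B' := boostedKerrBackground Λ c M a) (boostedKerrExterior_le_starBackground_domain Λ c M a rf)
    (fun _ ↦ rfl) hΨ hS k

/-- **… and it is the `Cᵏ` sup norm over the time-ZERO exterior truncated slab of the
`τ`-translate of the star deviation**: for a smooth star chart `Ψ`,
`truncDeviationCk (boostedKerrBackground Λ c M a) (Ψ ∘ ι) k R' τ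
  = ‖(Ψ^* g − g_{M,a,Λ,c})(· + τ • Λ∂₀)‖_{Cᵏ({t* = 0, r ≤ R'} ∩ {r > max r₊ 0})}`
(`truncDeviationCk_restrict_star_eq`, then the Killing translation `x ↦ x + τ • Λ∂₀` carries the
time-zero exterior truncated slab onto the one at time `τ` — `image_add_smul_truncTimeSlab` with
`KerrSchildChart.time_add_smul / radius_add_smul` — and commutes with derivatives,
`supCkENorm_comp_add_right`). The star twin of `truncDeviationCk_eq_supCkENorm_translate`: it turns
the crux's recurrence clause for the restricted chart into a statement about the translates of ONE
field on the star domain (Hale 1980, Ch. I, §8). [cite: Hale1980, Ch. I §8] -/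
theorem truncDeviationCk_restrict_star_eq_supCkENorm_translate (𝓢 : Spacetime 4) (Λ : lorentzGroup)
    (c : E4) (M a : ℝ) (rf : E4 → ℝ) {Ψ : (starBackground Λ c M a rf).domain → 𝓢.carrier}
    (hΨ : ContMDiff 𝓘(ℝ, E4) (𝓡 4) ∞ Ψ) (k : ℕ) (R' τ : ℝ) :
    𝓢.truncDeviationCk (boostedKerrBackground Λ c M a)
        (Ψ ∘ Opens.inclusion (boostedKerrExterior_le_starBackground_domain Λ c M a rf)) k R' τ =
      supCkENorm (Subtype.val '' (boostedKerrBackground Λ c M a).truncTimeSlab R' 0) k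
        (fun x ↦ 𝓢.deviationExtend (starBackground Λ c M a rf) Ψ
          (x + τ • (Λ : E4 ≃L[ℝ] E4) (EuclideanSpace.single (0 : Fin 4) (1 : ℝ)))) := by
  rw [supCkENorm_comp_add_right, image_add_smul_truncTimeSlab (boostedKerrBackground Λ c M a) _
    (add_smul_mem_boostedKerrBackground_domain Λ c M a) (KerrSchildChart.time_add_smul Λ c M a)
    (KerrSchildChart.radius_add_smul Λ c M a) R' 0 τ, zero_add]
  exact truncDeviationCk_restrict_star_eq 𝓢 Λ c M a rf hΨ k R' τ

/-- **A late chart for the star background restricts to a late chart for the exterior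
background** (same region `O`, same late time `τ₀`): the two backgrounds have the same time
function `t*(x) = (Λ⁻¹(x − c))⁰`, so `IsLateChart.comp_inclusion` applies along
`boostedKerrExterior_le_starBackground_domain`. Thus a star chart supplies the hole-chart data
`IsLateChart (boostedKerrBackground Λ c M a) O τ₀ (Ψ ∘ ι)` of `Recurs k 𝒟`
(Dafermos–Rodnianski 2008, §5.1). [cite: DafermosRodnianski2008, §5.1] -/
theorem isLateChart_restrict_star {𝓢 : Spacetime 4} {Λ : lorentzGroup} {c : E4} {M a : ℝ}
    {rf : E4 → ℝ} {O : Set 𝓢.carrier} {τ₀ : ℝ}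
    {Ψ : (starBackground Λ c M a rf).domain → 𝓢.carrier}
    (hΨ : 𝓢.IsLateChart (starBackground Λ c M a rf) O τ₀ Ψ) :
    𝓢.IsLateChart (boostedKerrBackground Λ c M a) O τ₀
      (Ψ ∘ Opens.inclusion (boostedKerrExterior_le_starBackground_domain Λ c M a rf)) :=
  hΨ.comp_inclusion (B' := boostedKerrBackground Λ c M a)
    (boostedKerrExterior_le_starBackground_domain Λ c M a rf) fun _ ↦ rfl

/-! ### Smoothness of the star deviation and ω-limits of tame star charts -/

/-- **The extended deviation `Ψ^* g − g_{M,a,Λ,c}` of a smooth star chart is `C^∞` on the star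
domain** `{r(Λ⁻¹(x − c)) > max M 0}`: the pullback `Ψ^* g` has smooth components
(`Spacetime.contDiffAt_deviationExtend_model`, O'Neill 1983, Ch. 3, Lemma 3.35) and the boosted
Kerr–Schild form is smooth wherever the rest-frame radius is positive
(`contDiffAt_boostedKerrBilin`; on the star domain `r > max M 0 ≥ 0`). The star twin of
`contDiffOn_deviationExtend_boostedKerr`.
[cite: ONeill1983, Ch. 3, Lemma 3.35] -/
theorem contDiffOn_deviationExtend_star (𝓢 : Spacetime 4) {Λ : lorentzGroup} {c : E4} {M a : ℝ}
    {rf : E4 → ℝ} {Ψ : (starBackground Λ c M a rf).domain → 𝓢.carrier}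
    (hΨ : ContMDiff 𝓘(ℝ, E4) (𝓡 4) ∞ Ψ) :
    ContDiffOn ℝ ∞ (𝓢.deviationExtend (starBackground Λ c M a rf) Ψ)
      ((starBackground Λ c M a rf).domain : Set E4) := by
  intro z hz
  have hz' : poincareInv Λ c z ∈ Kerr.region a M := hz
  have hr : 0 < Kerr.radius a (poincareInv Λ c z) := Kerr.radius_pos_of_mem_region hz'
  have hb : ContDiffAt ℝ ∞ (starBackground Λ c M a rf).bilin z :=
    contDiffAt_boostedKerrBilin Λ c M a hr
  exact (𝓢.contDiffAt_deviationExtend_model (starBackground Λ c M a rf) hΨ ⟨z, hz⟩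
    hb).contDiffWithinAt

/-- **Tame star charts have `Cᵏ_loc` ω-limits on the star domain along every `T n → ∞`** (the star
twin of `exists_omegaLimit_hole_translate`). Let `Ψ` be a smooth chart on the star background
`B★ = starBackground Λ c M a (x ↦ r_a(Λ⁻¹(x − c)))` (radius parameter the rest-frame Kerr–Schild
radius) whose deviation `dev★ = Ψ^* g − g_{M,a,Λ,c}` (extended by zero) has FINITE `C^{k+1}` sup
norm over every star truncated late region `{t* > τ₀, r ≤ R} ∩ {r > max M 0}` (tameness after `τ₀`,
now ACROSS the horizon). Then for every `T n → +∞` there are a `Cᵏ` field `g` on the star domain and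
a subsequence `φ` along which the translates `dev★ (· + T (φ n) • Λ∂₀)` converge to `g` in `Cᵏ` on
every compact subset of the star domain. Specialisation of
`exists_omegaLimit_translate_of_bounded_truncLateRegion`: the star domain is `Λ∂₀`-invariant
(`add_smul_mem_starBackground_domain`), `t*` is shifted and `r` preserved
(`KerrSchildChart.time_add_smul / radius_add_smul`, the star time and radius being those of
`boostedKerrBackground`), both are continuous, `dev★` is `C^∞` on the star domain
(`contDiffOn_deviationExtend_star`), and finite sup norms give pointwise bounds
(`norm_iteratedFDeriv_le_toReal_supCkENorm`). Hale 1980, Ch. I, §8; Petersen 2006, Ch. 10, §3.1.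
[cite: Petersen2006, Ch. 10 §3.1] -/
theorem exists_omegaLimit_starHole_translate (𝓢 : Spacetime 4) (Λ : lorentzGroup) (c : E4)
    (M a : ℝ) {Ψ : (starBackground Λ c M a fun x ↦ Kerr.radius a (poincareInv Λ c x)).domain →
      𝓢.carrier} (hΨ : ContMDiff 𝓘(ℝ, E4) (𝓡 4) ∞ Ψ) {k : ℕ} {τ₀ : ℝ}
    (hfin : ∀ R : ℝ, supCkENorm (Subtype.val ''
        (starBackground Λ c M a fun x ↦ Kerr.radius a (poincareInv Λ c x)).truncLateRegion τ₀ R)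
      (k + 1) (𝓢.deviationExtend
        (starBackground Λ c M a fun x ↦ Kerr.radius a (poincareInv Λ c x)) Ψ) ≠ ⊤)
    {T : ℕ → ℝ} (hT : Tendsto T atTop atTop) :
    ∃ (g : E4 → E4 →L[ℝ] E4 →L[ℝ] ℝ) (φ : ℕ → ℕ), StrictMono φ ∧
      ContDiffOn ℝ k g
        ((starBackground Λ c M a fun x ↦ Kerr.radius a (poincareInv Λ c x)).domain : Set E4) ∧
      ∀ K ⊆ ((starBackground Λ c M a fun x ↦ Kerr.radius a (poincareInv Λ c x)).domain : Set E4),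
        IsCompact K →
        Tendsto (fun n ↦ supCkENorm K k (fun x ↦
          𝓢.deviationExtend (starBackground Λ c M a fun x ↦ Kerr.radius a (poincareInv Λ c x)) Ψ
            (x + T (φ n) • (Λ : E4 ≃L[ℝ] E4) (EuclideanSpace.single (0 : Fin 4) (1 : ℝ))) - g x))
          atTop (𝓝 0) := by
  -- the star time `t*(x) = (Λ⁻¹(x − c))⁰` is shifted and the radius `r(Λ⁻¹(x − c))` preserved
  have htime : ∀ (x : E4) (s : ℝ),
      (starBackground Λ c M a fun x ↦ Kerr.radius a (poincareInv Λ c x)).time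
          (x + s • (Λ : E4 ≃L[ℝ] E4) (EuclideanSpace.single (0 : Fin 4) (1 : ℝ))) =
        (starBackground Λ c M a fun x ↦ Kerr.radius a (poincareInv Λ c x)).time x + s :=
    KerrSchildChart.time_add_smul Λ c M a
  have hrad : ∀ (x : E4) (s : ℝ),
      (starBackground Λ c M a fun x ↦ Kerr.radius a (poincareInv Λ c x)).radius
          (x + s • (Λ : E4 ≃L[ℝ] E4) (EuclideanSpace.single (0 : Fin 4) (1 : ℝ))) =
        (starBackground Λ c M a fun x ↦ Kerr.radius a (poincareInv Λ c x)).radius x :=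
    KerrSchildChart.radius_add_smul Λ c M a
  -- both are continuous
  have htc : Continuous (starBackground Λ c M a fun x ↦ Kerr.radius a (poincareInv Λ c x)).time :=
    (PiLp.continuous_apply 2 _ 0).comp (continuous_poincareInv Λ c)
  have hrc :
      Continuous (starBackground Λ c M a fun x ↦ Kerr.radius a (poincareInv Λ c x)).radius :=
    (Kerr.continuous_radius a).comp (continuous_poincareInv Λ c)
  -- the star deviation is `C^∞`, hence `C^{k+1}`, on the star domain
  have hh : ContDiffOn ℝ (k + 1)
      (𝓢.deviationExtend (starBackground Λ c M a fun x ↦ Kerr.radius a (poincareInv Λ c x)) Ψ)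
      ((starBackground Λ c M a fun x ↦ Kerr.radius a (poincareInv Λ c x)).domain : Set E4) :=
    (contDiffOn_deviationExtend_star 𝓢 hΨ).of_le (by exact_mod_cast le_top)
  -- tameness: pointwise bounds on the star truncated late regions
  have hb : ∀ R : ℝ, ∃ C : ℝ, ∀ i, i ≤ k + 1 → ∀ x ∈ Subtype.val ''
      (starBackground Λ c M a fun x ↦ Kerr.radius a (poincareInv Λ c x)).truncLateRegion τ₀ R,
        ‖iteratedFDeriv ℝ i (𝓢.deviationExtend
          (starBackground Λ c M a fun x ↦ Kerr.radius a (poincareInv Λ c x)) Ψ) x‖ ≤ C :=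
    fun R ↦ ⟨_, fun _ hi _ hx ↦ norm_iteratedFDeriv_le_toReal_supCkENorm hi hx _ (hfin R)⟩
  exact exists_omegaLimit_translate_of_bounded_truncLateRegion
    (starBackground Λ c M a fun x ↦ Kerr.radius a (poincareInv Λ c x))
    ((Λ : E4 ≃L[ℝ] E4) (EuclideanSpace.single (0 : Fin 4) (1 : ℝ)))
    (add_smul_mem_starBackground_domain Λ c M a _) htime hrad htc hrc hh hb hT

/-! ### The dictionary: the restricted chart recurs iff the ω-limit is flat on the exterior slab -/

/-- **Registered structure stub (crux stmt-FinalStateConjecture-14664, line `Sketch`, stub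
`StarHoleDictionary`): the ω-limit dictionary in crux currency, for hole charts defined across the
horizon.** Let `(M, a)` be sub-extremal, `Ψ` a smooth chart of the spacetime `𝓢` on the star
background `starBackground Λ c M a rf` (domain `{r(Λ⁻¹(x − c)) > max M 0}`, any radius parameter
`rf`), `dev★ = Ψ^* g − g_{M,a,Λ,c}` its extended deviation, `g` a `Cᵏ` field on the star domain and
`T n` chart times along which the translates `dev★ (· + T n • Λ∂₀)` converge to `g` in `Cᵏ` on every
compact subset of the star domain (an ω-limit along `T`; these exist along subsequences for tame
charts, `exists_omegaLimit_starHole_translate`). Then the RESTRICTED chart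
`Ψ ∘ ι : (boostedKerrBackground Λ c M a).domain → 𝓢` — the hole chart the crux's `Recurs k 𝒟` sees —
recurs at EVERY exterior radius along `T`, i.e.
`truncDeviationCk (boostedKerrBackground Λ c M a) (Ψ ∘ ι) k R' (T n) → 0` for every `R'`, IF AND
ONLY IF all derivatives of `g` of order `≤ k` vanish on the exterior time-zero slab
`{t* = 0} ∩ {r > max r₊ 0}`. Proof: each `truncDeviationCk … R' (T n)` is the `Cᵏ` sup norm over the
time-zero exterior truncated slab of the translate `dev★ (· + T n • Λ∂₀)`
(`truncDeviationCk_restrict_star_eq_supCkENorm_translate`), `dev★` is `C^∞` on the star domain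
(`contDiffOn_deviationExtend_star`), and the equivalence for fields on the star domain is
`tendsto_supCkENorm_truncTimeSlab_translate_iff_iteratedFDeriv_eq_zero_timeSlab`
(`…PenetratingSlab`: the closed slabs `{t* = 0, r₊ ≤ r ≤ R'}` are compact inside the star domain, so
the "one asymmetry" of the dictionary on the bare exterior chart disappears for charts with
margin). LaSalle: the orbit recurs to the reference configuration along `T` iff the latter is its
ω-limit along `T` (Hale 1980, Ch. I, §8; Kerr-star charts across `𝓗⁺`: Dafermos–Rodnianski 2008,
§5.1). Closed form. [cite: Hale1980, Ch. I §8] -/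
theorem tendsto_truncDeviationCk_restrict_star_iff_iteratedFDeriv_omegaLimit_eq_zero :
    ∀ (𝓢 : Spacetime 4) (Λ : lorentzGroup) (c : E4) {M a : ℝ}, Kerr.IsSubextremal M a →
      ∀ (rf : E4 → ℝ) {Ψ : (starBackground Λ c M a rf).domain → 𝓢.carrier},
      ContMDiff 𝓘(ℝ, E4) (𝓡 4) ∞ Ψ →
      ∀ {k : ℕ} {g : E4 → E4 →L[ℝ] E4 →L[ℝ] ℝ},
      ContDiffOn ℝ k g ((starBackground Λ c M a rf).domain : Set E4) →
      ∀ {T : ℕ → ℝ},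
      (∀ K ⊆ ((starBackground Λ c M a rf).domain : Set E4), IsCompact K →
        Tendsto (fun n ↦ supCkENorm K k (fun x ↦
          𝓢.deviationExtend (starBackground Λ c M a rf) Ψ
            (x + T n • (Λ : E4 ≃L[ℝ] E4) (EuclideanSpace.single (0 : Fin 4) (1 : ℝ))) - g x))
          atTop (𝓝 0)) →
      ((∀ R' : ℝ, Tendsto (fun n ↦ 𝓢.truncDeviationCk (boostedKerrBackground Λ c M a)
          (Ψ ∘ Opens.inclusion (boostedKerrExterior_le_starBackground_domain Λ c M a rf))
          k R' (T n)) atTop (𝓝 0)) ↔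
        ∀ x ∈ Subtype.val '' (boostedKerrBackground Λ c M a).timeSlab 0, ∀ m, m ≤ k →
          iteratedFDeriv ℝ m g x = 0) := by
  intro 𝓢 Λ c M a hMa rf Ψ hΨ k g hg T hlim
  -- the star deviation is `C^{k+1}` on the star domain
  have hh : ContDiffOn ℝ (k + 1) (𝓢.deviationExtend (starBackground Λ c M a rf) Ψ)
      ((starBackground Λ c M a rf).domain : Set E4) :=
    (contDiffOn_deviationExtend_star 𝓢 hΨ).of_le (by exact_mod_cast le_top)
  -- the crux's recurrence clause is `Cᵏ`-smallness of the translates on the time-zero slabs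
  refine Iff.trans (forall_congr' fun R' ↦ ?_)
    (tendsto_supCkENorm_truncTimeSlab_translate_iff_iteratedFDeriv_eq_zero_timeSlab Λ c hMa rf
      hh hg hlim)
  simp only [truncDeviationCk_restrict_star_eq_supCkENorm_translate 𝓢 Λ c M a rf hΨ]

/-- **A tame star chart whose restriction recurs along `T n → ∞` has a flat ω-limit on the CLOSED
slab along `T`.** Let `(M, a)` be sub-extremal and `Ψ` a smooth chart on the star background
`starBackground Λ c M a (x ↦ r_a(Λ⁻¹(x − c)))`, tame after `τ₀` (finite `C^{k+1}` sup norm of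
`dev★ = Ψ^* g − g_{M,a,Λ,c}` over every star truncated late region `{t* > τ₀, r ≤ R}`), and let
`T n → +∞` be chart times along which the restricted hole chart `Ψ ∘ ι` on
`boostedKerrBackground Λ c M a` recurs at every radius
(`truncDeviationCk (boostedKerrBackground Λ c M a) (Ψ ∘ ι) k R' (T n) → 0` for all `R'`). Then there
are a `Cᵏ` field `g` on the star domain and a subsequence `φ` such that the `T (φ n)`-translates of
`dev★` converge to `g` in `Cᵏ` on every compact subset of the STAR domain, and `g` is flat to order
`k` at every `x` with `t*(x) = 0` and `r(Λ⁻¹(x − c)) ≥ r₊` — the closed time-zero slab, horizon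
included: `exists_omegaLimit_starHole_translate`, the forward direction of
`tendsto_truncDeviationCk_restrict_star_iff_iteratedFDeriv_omegaLimit_eq_zero` along `T ∘ φ`, and
continuity of the jets of `g` up to the horizon
(`iteratedFDeriv_eq_zero_closedSlab_of_eq_zero_timeSlab`). The star upgrade of
`hole_omegaLimit_flat_of_recurrence` (Hale 1980, Ch. I, §8; Dafermos–Rodnianski 2008, §5.1).
[cite: Hale1980, Ch. I §8] -/
theorem starHole_omegaLimit_flat_of_recurrence (𝓢 : Spacetime 4) (Λ : lorentzGroup) (c : E4)
    {M a : ℝ} (hMa : Kerr.IsSubextremal M a)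
    {Ψ : (starBackground Λ c M a fun x ↦ Kerr.radius a (poincareInv Λ c x)).domain → 𝓢.carrier}
    (hΨ : ContMDiff 𝓘(ℝ, E4) (𝓡 4) ∞ Ψ) {k : ℕ} {τ₀ : ℝ}
    (hfin : ∀ R : ℝ, supCkENorm (Subtype.val ''
        (starBackground Λ c M a fun x ↦ Kerr.radius a (poincareInv Λ c x)).truncLateRegion τ₀ R)
      (k + 1) (𝓢.deviationExtend
        (starBackground Λ c M a fun x ↦ Kerr.radius a (poincareInv Λ c x)) Ψ) ≠ ⊤)
    {T : ℕ → ℝ} (hT : Tendsto T atTop atTop)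
    (hrec : ∀ R' : ℝ, Tendsto (fun n ↦ 𝓢.truncDeviationCk (boostedKerrBackground Λ c M a)
      (Ψ ∘ Opens.inclusion (boostedKerrExterior_le_starBackground_domain Λ c M a
        fun x ↦ Kerr.radius a (poincareInv Λ c x))) k R' (T n)) atTop (𝓝 0)) :
    ∃ (g : E4 → E4 →L[ℝ] E4 →L[ℝ] ℝ) (φ : ℕ → ℕ), StrictMono φ ∧
      ContDiffOn ℝ k g
        ((starBackground Λ c M a fun x ↦ Kerr.radius a (poincareInv Λ c x)).domain : Set E4) ∧
      (∀ K ⊆ ((starBackground Λ c M a fun x ↦ Kerr.radius a (poincareInv Λ c x)).domain : Set E4),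
        IsCompact K →
        Tendsto (fun n ↦ supCkENorm K k (fun x ↦
          𝓢.deviationExtend (starBackground Λ c M a fun x ↦ Kerr.radius a (poincareInv Λ c x)) Ψ
            (x + T (φ n) • (Λ : E4 ≃L[ℝ] E4) (EuclideanSpace.single (0 : Fin 4) (1 : ℝ))) - g x))
          atTop (𝓝 0)) ∧
      ∀ x : E4, poincareInv Λ c x 0 = 0 → Kerr.rPlus M a ≤ Kerr.radius a (poincareInv Λ c x) →
        ∀ m, m ≤ k → iteratedFDeriv ℝ m g x = 0 := by
  obtain ⟨g, φ, hφ, hg, hlim⟩ := exists_omegaLimit_starHole_translate 𝓢 Λ c M a hΨ hfin hT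
  -- along `T ∘ φ` the restricted chart still recurs, so `g` is flat on the open exterior slab
  have hflat : ∀ x ∈ Subtype.val '' (boostedKerrBackground Λ c M a).timeSlab 0, ∀ m, m ≤ k →
      iteratedFDeriv ℝ m g x = 0 :=
    (tendsto_truncDeviationCk_restrict_star_iff_iteratedFDeriv_omegaLimit_eq_zero 𝓢 Λ c hMa _ hΨ
      hg hlim).1 fun R' ↦ (hrec R').comp hφ.tendsto_atTop
  exact ⟨g, φ, hφ, hg, hlim,
    iteratedFDeriv_eq_zero_closedSlab_of_eq_zero_timeSlab Λ c hMa _ hg hflat⟩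

end Summit.FinalStateConjecture.FinalStateConjecture.Theorems.ClusterCompleteness

end
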